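import Mathlib
import Summits.Ventures.PercRepro2.Defs
import Summits.Ventures.PercRepro2.Independence
import Summits.Ventures.PercRepro2.Harris
import Summits.Ventures.PercRepro2.Graph
import Summits.Ventures.PercRepro2.Exploration
import Summits.Ventures.PercRepro2.Events
import Summits.Ventures.PercRepro2.FourFunctions
import Summits.Ventures.PercRepro2.Induced
import Summits.Ventures.PercRepro2.Frontier
import Summits.Ventures.PercRepro2.ObsIndependence
import Summits.Ventures.PercRepro2.BHK
import Summits.Ventures.PercRepro2.BHKEvents
import Summits.Ventures.PercRepro2.CaseOneRegime
import Summits.Ventures.PercRepro2.CaseOnePos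
import Summits.Ventures.PercRepro2.CaseOneJ11
import Summits.Ventures.PercRepro2.CaseOneRV

/-!
# The S = C₁-revealed form of (ii): `(SC) ⟹ (ii) = (RV)` (blind cell PercRepro2, p1 g13;
ASSIGNMENTS v12.48 «p1: `(SC) ⟹ (ii)` as a Lean statement»; lead g24 INBOX 23:45Z «THE S = C₁-REVEALED
FORMS OF (i) AND (ii)»)

Reveal `S = C(a₁)` under `Q`; `h_x(S) = P_{G−S}(x ∈ C(a₂))` is the tree's `delClusterProb p ends a₂
{S' ∣ x ∈ S'} S` (`π′_S(x)`), `e = 1[a₃ ∈ S]`. The lead's exact identities: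
`(ii) = E_Q[e · Cov_{G−S}(b, o ∈ C(a₂))] + Cov_{S∼Q}(h_b, e · (h_o − γ))`, first term `≥ 0` (Harris on
`G − S`), so **`(SC) := Cov_{S∼Q}(h_b, e · (h_o − γ)) ≥ 0`** strengthens `(ii) = (RV)` by exactly the
Harris slack (census: n = 5 random + exhaustive binary m ≤ 6, 0 failures; tight on the theta instance;
the exhaustive n = 6 bar = kit j229913). Cleared by `D · P(Q)²`: with **`covH F := P(Q) E[h_b F(C₁) 1_Q] −
E[h_b 1_Q] E[F(C₁) 1_Q]`** (the cleared `Cov_μ(h_b(C₁), F(C₁))`) and `caseOneFun D_o D = e · (D_o − D h_o)`,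
**`scExpr := −covH (caseOneFun D_o D)`**, **`SC := 0 ≤ scExpr`** (a definition only), and the
Harris term **`harrisTerm := P(Q) · E[e · D · (π_{C₁}({b, o}) − π′_{C₁}(b) π′_{C₁}(o)) · 1_Q] ≥ 0`**
(**`harrisTerm_nonneg`**, from `delClusterProb_mul_le`). The kernel identity
**`iiExpr_eq_harris_add_sc`**: `iiExpr = harrisTerm + scExpr` (four tower identities
`expect_clusterFun_inter_eq_expect` + linearity), hence **`zSplitII_of_sc`**: `(SC) ⟹ (ii)` and
**`rv_of_sc`**: `(SC) ⟹ (RV)` (when `P(T′) > 0`). Nothing about `(SC)` itself is claimed. -/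

namespace Summit.Ventures.PercRepro2

namespace CaseOne

section Defs
variable {V : Type*} {E : Type*} [Fintype E] [DecidableEq E] {R : Type*} [CommRing R]

/-- `π′_S(x) = P_{G−S}(x ∈ C(a₂))` — the lead's `h_x(S)`. -/
noncomputable def hFun (p : E → R) (ends : E → Sym2 V) (a₂ x : V) (S : Set V) : R :=
  delClusterProb p ends a₂ {S' : Set V | x ∈ S'} S

/-- **The cleared covariance of `h_b(C₁)` with a cluster functional of `C₁`**:
`P(Q) E[h_b F(C₁) 1_Q] − E[h_b 1_Q] E[F(C₁) 1_Q]`. -/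
noncomputable def covH (p : E → R) (ends : E → Sym2 V) (a₁ a₂ b : V) (F : Set V → R) : R :=
  prob p (connEvent ends a₁ a₂)ᶜ *
      expect p (fun ω => hFun p ends a₂ b (cluster ends ω a₁) * F (cluster ends ω a₁) *
        ((connEvent ends a₁ a₂)ᶜ).indicator 1 ω) -
    expect p (fun ω => hFun p ends a₂ b (cluster ends ω a₁) * ((connEvent ends a₁ a₂)ᶜ).indicator 1 ω) *
      expect p (fun ω => F (cluster ends ω a₁) * ((connEvent ends a₁ a₂)ᶜ).indicator 1 ω)

/-- **(SC), cleared by `D P(Q)²`**: `−covH (caseOneFun D_o D) = D P(Q)² Cov_μ(h_b, e (h_o − γ))`. -/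
noncomputable def scExpr (p : E → R) (ends : E → Sym2 V) (o a₁ a₂ a₃ b : V) : R :=
  -covH p ends a₁ a₂ b (caseOneFun p ends o a₂ a₃ (Dpdo p ends o a₁ a₂ a₃) (Dpd p ends a₁ a₂ a₃))

/-- **The Harris term of the S-revealed (ii)**, cleared:
`P(Q) · E[e · D · (π_{C₁}({b,o}) − π′_{C₁}(b) π′_{C₁}(o)) · 1_Q]`. -/
noncomputable def harrisTerm (p : E → R) (ends : E → Sym2 V) (o a₁ a₂ a₃ b : V) : R :=
  prob p (connEvent ends a₁ a₂)ᶜ *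
    expect p (fun ω => ({W' : Set V | a₃ ∈ W'}).indicator 1 (cluster ends ω a₁) *
      (Dpd p ends a₁ a₂ a₃ *
        (delClusterProb p ends a₂ ({S : Set V | b ∈ S} ∩ {S : Set V | o ∈ S}) (cluster ends ω a₁) -
          hFun p ends a₂ b (cluster ends ω a₁) * hFun p ends a₂ o (cluster ends ω a₁))) *
      ((connEvent ends a₁ a₂)ᶜ).indicator 1 ω)

end Defs

section Props
variable {V : Type*} {E : Type*} [Fintype E] [DecidableEq E] {R : Type*} [CommRing R] [LinearOrder R]

/-- **(SC)** — the S = C₁-revealed candidate strengthening of `(RV)`: `Cov_{S∼Q}(h_b, e (h_o − γ)) ≥ 0`,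
cleared. A definition only (CANDIDATE; n = 5 random + exhaustive binary m ≤ 6: 0 failures; tight on
theta; NOT a row until the exhaustive n = 6 bar). -/
def SC (p : E → R) (ends : E → Sym2 V) (o a₁ a₂ a₃ b : V) : Prop :=
  0 ≤ scExpr p ends o a₁ a₂ a₃ b

end Props

section Identity
variable {V : Type*} {E : Type*} [Fintype E] [DecidableEq E] [Fintype V] [DecidableEq V]
  {R : Type*} [CommRing R] [LinearOrder R] [IsStrictOrderedRing R]

omit [Fintype V] [DecidableEq V] in
/-- `{S ∋ v}` is an up-set of vertex sets. -/
private lemma isUpperSet_mem₃ (v : V) : IsUpperSet {S : Set V | v ∈ S} :=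
  fun _ _ h hv => h hv

omit [Fintype V] [DecidableEq V] in
/-- **The Harris term is nonnegative** (Harris in `G − C₁`, `delClusterProb_mul_le`; `D ≥ 0`). -/
theorem harrisTerm_nonneg (p : E → R) (hp : IsProbVec p) (ends : E → Sym2 V) (o a₁ a₂ a₃ b : V) :
    0 ≤ harrisTerm p ends o a₁ a₂ a₃ b := by
  unfold harrisTerm
  refine mul_nonneg (prob_nonneg hp _) (expect_nonneg hp fun ω => ?_)
  refine mul_nonneg (mul_nonneg (Set.indicator_apply_nonneg fun _ => zero_le_one) ?_)
    (Set.indicator_apply_nonneg fun _ => zero_le_one)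
  refine mul_nonneg (prob_nonneg hp _) ?_
  have := delClusterProb_mul_le p hp ends a₂ (cluster ends ω a₁) (isUpperSet_mem₃ (V := V) b)
    (isUpperSet_mem₃ (V := V) o)
  unfold hFun
  linarith

omit [DecidableEq V] [LinearOrder R] [IsStrictOrderedRing R] in
/-- **`iiExpr = harrisTerm + scExpr`** — the lead's S = C₁-revealed identity for (ii), in the kernel. -/
theorem iiExpr_eq_harris_add_sc (p : E → R) (ends : E → Sym2 V) (o a₁ a₂ a₃ b : V) :
    iiExpr p ends o a₁ a₂ a₃ b = harrisTerm p ends o a₁ a₂ a₃ b + scExpr p ends o a₁ a₂ a₃ b := by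
  classical
  unfold iiExpr scExpr covH harrisTerm zFun caseOneFun hFun
  set Q := (connEvent ends a₁ a₂)ᶜ with hQ
  set D := Dpd p ends a₁ a₂ a₃ with hD
  set Do := Dpdo p ends o a₁ a₂ a₃ with hDo
  set I₃ : Set V → R := ({W' : Set V | a₃ ∈ W'}).indicator 1 with hI₃
  set πb := delClusterProb p ends a₂ {S : Set V | b ∈ S} with hπb
  set πo := delClusterProb p ends a₂ {S : Set V | o ∈ S} with hπo
  set πbo := delClusterProb p ends a₂ ({S : Set V | b ∈ S} ∩ {S : Set V | o ∈ S}) with hπbo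
  -- connection indicators as cluster indicators
  have hb2 : ∀ ω, (connEvent ends a₂ b).indicator (1 : Config E → R) ω =
      ({S : Set V | b ∈ S}).indicator 1 (cluster ends ω a₂) := fun ω => (ind_cluster_eq ends a₂ b ω).symm
  have ho2 : ∀ ω, (connEvent ends a₂ o).indicator (1 : Config E → R) ω =
      ({S : Set V | o ∈ S}).indicator 1 (cluster ends ω a₂) := fun ω => (ind_cluster_eq ends a₂ o ω).symm
  have ha1 : ∀ ω, (connEvent ends a₁ a₃).indicator (1 : Config E → R) ω = I₃ (cluster ends ω a₁) :=
    fun ω => (ind_cluster_eq ends a₁ a₃ ω).symm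
  simp only [hb2, ho2, ha1]
  -- the four tower identities
  have t1 := expect_clusterFun_inter_eq_expect p ends a₁ a₂ I₃
    ({S : Set V | b ∈ S} ∩ {S : Set V | o ∈ S})
  have t2 := expect_clusterFun_inter_eq_expect p ends a₁ a₂ I₃ {S : Set V | b ∈ S}
  have t3 := expect_clusterFun_inter_eq_expect p ends a₁ a₂ (fun _ => (1 : R)) {S : Set V | b ∈ S}
  have t4 := expect_clusterFun_inter_eq_expect p ends a₁ a₂ I₃ {S : Set V | o ∈ S}
  simp only [one_mul] at t3
  -- expand the three `iiExpr` expectations into atoms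
  have e1 : expect p (fun ω => ({S : Set V | b ∈ S}).indicator (1 : Set V → R) (cluster ends ω a₂) *
      (I₃ (cluster ends ω a₁) * (D * ({S : Set V | o ∈ S}).indicator 1 (cluster ends ω a₂) - Do)) *
      Q.indicator 1 ω) =
      D * expect p (fun ω => I₃ (cluster ends ω a₁) *
          ({S : Set V | b ∈ S} ∩ {S : Set V | o ∈ S}).indicator 1 (cluster ends ω a₂) *
          Q.indicator 1 ω) -
        Do * expect p (fun ω => I₃ (cluster ends ω a₁) *
          ({S : Set V | b ∈ S}).indicator 1 (cluster ends ω a₂) * Q.indicator 1 ω) := by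
    rw [← expect_const_mul, ← expect_const_mul, ← expect_sub]
    congr 1
    funext ω
    simp only [Pi.sub_apply, Set.inter_indicator_one, Pi.mul_apply]
    ring
  have e2 : expect p (fun ω => I₃ (cluster ends ω a₁) *
      (D * ({S : Set V | o ∈ S}).indicator (1 : Set V → R) (cluster ends ω a₂) - Do) *
      Q.indicator 1 ω) =
      D * expect p (fun ω => I₃ (cluster ends ω a₁) *
          ({S : Set V | o ∈ S}).indicator 1 (cluster ends ω a₂) * Q.indicator 1 ω) -
        Do * expect p (fun ω => I₃ (cluster ends ω a₁) * Q.indicator 1 ω) := by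
    rw [← expect_const_mul, ← expect_const_mul, ← expect_sub]
    congr 1
    funext ω
    simp only [Pi.sub_apply]
    ring
  rw [e1, e2, t1, t2, t3, t4]
  -- expand the `scExpr` / `harrisTerm` expectations
  have e3 : expect p (fun ω => πb (cluster ends ω a₁) *
      (I₃ (cluster ends ω a₁) * (Do - D * πo (cluster ends ω a₁))) * Q.indicator 1 ω) =
      Do * expect p (fun ω => πb (cluster ends ω a₁) * I₃ (cluster ends ω a₁) * Q.indicator 1 ω) -
        D * expect p (fun ω => I₃ (cluster ends ω a₁) * πb (cluster ends ω a₁) *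
          πo (cluster ends ω a₁) * Q.indicator 1 ω) := by
    rw [← expect_const_mul, ← expect_const_mul, ← expect_sub]
    congr 1
    funext ω
    simp only [Pi.sub_apply]
    ring
  have e4 : expect p (fun ω => I₃ (cluster ends ω a₁) * (Do - D * πo (cluster ends ω a₁)) *
      Q.indicator 1 ω) =
      Do * expect p (fun ω => I₃ (cluster ends ω a₁) * Q.indicator 1 ω) -
        D * expect p (fun ω => I₃ (cluster ends ω a₁) * πo (cluster ends ω a₁) * Q.indicator 1 ω) := by
    rw [← expect_const_mul, ← expect_const_mul, ← expect_sub]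
    congr 1
    funext ω
    simp only [Pi.sub_apply]
    ring
  have e5 : expect p (fun ω => I₃ (cluster ends ω a₁) *
      (D * (πbo (cluster ends ω a₁) - πb (cluster ends ω a₁) * πo (cluster ends ω a₁))) *
      Q.indicator 1 ω) =
      D * expect p (fun ω => I₃ (cluster ends ω a₁) * πbo (cluster ends ω a₁) * Q.indicator 1 ω) -
        D * expect p (fun ω => I₃ (cluster ends ω a₁) * πb (cluster ends ω a₁) *
          πo (cluster ends ω a₁) * Q.indicator 1 ω) := by
    rw [← expect_const_mul, ← expect_const_mul, ← expect_sub]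
    congr 1
    funext ω
    simp only [Pi.sub_apply]
    ring
  have e6 : expect p (fun ω => πb (cluster ends ω a₁) * I₃ (cluster ends ω a₁) * Q.indicator 1 ω) =
      expect p (fun ω => I₃ (cluster ends ω a₁) * πb (cluster ends ω a₁) * Q.indicator 1 ω) := by
    congr 1
    funext ω
    ring
  rw [e3, e4, e5, e6]
  ring

end Identity

section Chain
variable {V : Type*} {E : Type*} [Fintype E] [DecidableEq E] [Fintype V] [DecidableEq V]
  {R : Type*} [CommRing R] [LinearOrder R] [IsStrictOrderedRing R]

omit [DecidableEq V] in
/-- **`(SC) ⟹ (ii)`** (the Z-split half `ZSplitII`). -/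
theorem zSplitII_of_sc (p : E → R) (hp : IsProbVec p) (ends : E → Sym2 V) (o a₁ a₂ a₃ b : V)
    (h : SC p ends o a₁ a₂ a₃ b) : ZSplitII p ends o a₁ a₂ a₃ b := by
  unfold SC at h
  unfold ZSplitII
  rw [iiExpr_eq_harris_add_sc]
  have := harrisTerm_nonneg p hp ends o a₁ a₂ a₃ b
  linarith

omit [DecidableEq V] in
/-- **`(SC) ⟹ (RV)`** when the required-vertex world has positive mass. -/
theorem rv_of_sc (p : E → R) (hp : IsProbVec p) (ends : E → Sym2 V) (o a₁ a₂ a₃ b : V)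
    (hT : 0 < prob p (Tp ends a₁ a₂ a₃)) (h : SC p ends o a₁ a₂ a₃ b) :
    RV p ends o a₁ a₂ a₃ b :=
  (rv_iff_ii p ends o a₁ a₂ a₃ b hT).2 (zSplitII_of_sc p hp ends o a₁ a₂ a₃ b h)

end Chain

end CaseOne

end Summit.Ventures.PercRepro2
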